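import Summits.CriticalPhenomena.CardyFormulaZ2.Theorems.CardyComplexConeParafermionToSLESixFamiliesIicDefs
import Summits.CriticalPhenomena.CardyFormulaZ2.Theorems.CardyComplexConeParafermionToSLESixFamiliesDefs
import HarnessLib

/-!
# Vocabulary of line `flip-involution-return-law` for crux `ParafermionToSLESixFamilies` (stmt-CriticalPhenomena-11389)

Route `CardyComplexCone` (sub-problem `CriticalPhenomena/CardyFormulaZ2`), crux
`Summit.CriticalPhenomena.CardyFormulaZ2.Theses.CardyComplexCone.ParafermionToSLESixFamilies` (literally
`WeakHolFamilies → PrecompactFamilies → SLESixAllFamilies`, the three blocks of `…IicDefs.lean`). This file is the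
**definitions module** of the checked skeleton `Cruxes/ParafermionToSLESixFamilies/Lines/flip_involution_return_law.lean`
(planner `planner-cruxplan-stmt-CriticalPhenomena-11389-flip-involution-retu-0`, lead
`prover-line-stmt-CriticalPhenomena-11389-a2-0`): it carries, sorry-free, the skeleton's VOCABULARY — the visit /
arrival-phase / turn / return bookkeeping of the medial exploration path (`arrW`, `turnSign`, `phase`, `firstPhase`,
`inOutSum`, `S1`, `Yplus`, `Yminus`, `inOut`, `gTilt`), the all-diagonal geometry (`IsDiagDir`, `IsDiagFreeWindow`,
`TouchLawPosDiag`, `IsDiagRectilinear`, `IdentOnDiagRectilinear`) and the four typed statements of the line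
(`ReturnLaw`, `StaggerSummedVanishing`, `MesoEnvelope`, `DiagHalfPlaneOneArmLower`) — so that the stub helper files
`Theorems/CardyComplexConeParafermionToSLESixFamiliesFlip<Stub>.lean` (each proving `theorem stub_<x> : <signature>` by
name, `--supports stmt-CriticalPhenomena-11389`) and the closing skeleton share ONE copy of every object. NOTHING here is
asserted: every `def … : Prop` is a stub statement or a hypothesis of one (`MesoEnvelope`, `DiagHalfPlaneOneArmLower` and
the summed tilt law behind `StaggerSummedVanishing` are acknowledged open percolation inputs of conjecture strength;
`ReturnLaw` is an exact finite-volume identity, provable from the tree's edge-flip machinery). The one theorem is the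
registered algebraic glue `inOut_eq_tilt_form` (RL (ii)+(iii) in tilt form).

Change w.r.t. the planner's skeleton (lead's reshape, recorded in the line file): `ReturnLaw` is stated for INTERIOR free
edges — `z` an edge of `Ω_δ` with both endpoints off both discrete arcs (the hypothesis form of the tree's `q = 1` vertex
relation `EdgePrecompact.QkzStripBoundaryArm.cornerObs_vertexRelation`; it implies `DiscreteDobrushin.IsFreeEdge z`) —
instead of all free edges: the consumers of RL in the line (`stub_staggerSummed`, compacts `K ⊂ D`; the touch analysis on
free-arc windows) never meet an edge with an endpoint ON the wired arc `A`, and the interior form is the one the landed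
once/twice rearrangement lemmas (`InterfaceRearrangement.cornerOrbit_toggle_case1/2`, `spliceLoop_turning_eq`) speak about.

Sources: H. Duminil-Copin, S. Smirnov, *Conformal invariance of lattice models*, arXiv:1109.1549, §8 (Prop. 8.6: the
edge flip; Conj. 8.7); S. Smirnov, Ann. of Math. 172 (2010), proof of Lemma 4.5 (the involution `ω ↦ ω △ {e}` and its
once/twice table); Y. Ikhlef, A. Ponsaing, J. Phys. A 45 (2012), Prop. 4.7; F. Camia, C. Newman, PTRF 139 (2007).
-/

noncomputable section

open scoped Topology NNReal ENNReal BigOperators Classical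
open Filter Set MeasureTheory Metric
open Literature.Probability Literature.Probability.LatticeModels Literature.Probability.Percolation
open Literature.Probability.RandomPlanarGeometry
open Literature.Barriers.CriticalPhenomena (medialVertexOf)
open Summit.CriticalPhenomena.CardyFormulaZ2.Cruxes.ParafermionToSLESixFamilies.IicTraceFluxPairing
open Summit.CriticalPhenomena.CardyFormulaZ2.Cruxes.ParafermionToSLESixFamilies.CaratheodoryNetSlitUniformity (obs Pc)
open Summit.CriticalPhenomena.CardyFormulaZ2.Cruxes.EdgePrecompact.QkzStripBoundaryArm (cornerObs)

namespace Summit.CriticalPhenomena.CardyFormulaZ2.Cruxes.ParafermionToSLESixFamilies.FlipInvolutionReturnLaw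

/-! ## §1 Vocabulary of the line: visits, arrival phases, turns, returns -/

/-- The ARRIVAL winding of the medial path `γ` (mesh `δ`) at its position `k`: the winding of the polyline
prefix `p₀ … p_k` (direction of the in-dart `p_{k-1} → p_k` measured from the first segment; `0` for
`k ≤ 1`). The tree's bisected `MedialPath.windingAt γ δ k` is `arrW γ δ k + (turn at k)/2`, and the phase of
`cornerObs` on the in-dart at a visit `k` is that of `arrW γ δ k`, on the out-dart that of `arrW γ δ (k+1)`. -/
def arrW (γ : List MedialVertex) (δ : ℝ) (k : ℕ) : ℝ :=
  Polyline.winding ((γ.map (medialPoint δ)).take (k + 1))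

/-- The TURN of `γ` at position `k` in units of `π/2` (`+1` = left/counter-clockwise, `−1` = right): winding
on departure minus winding on arrival. At an interior visit of a genuine medial path it is `±1` exactly
(consecutive darts are perpendicular, `Complex.arg (±I) = ±π/2`). -/
def turnSign (γ : List MedialVertex) (δ : ℝ) (k : ℕ) : ℝ :=
  (arrW γ δ (k + 1) - arrW γ δ k) / (Real.pi / 2)

/-- The spin-`1/3` phase of a winding: `exp (−(i/3)·W)`. -/
def phase (W : ℝ) : ℂ := Complex.exp (-(Complex.I / 3) * (W : ℂ))

/-- The FIRST-ARRIVAL phase `Φ₁` of `γ` at the medial vertex `z` (`0` if `γ` does not visit `z`). -/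
def firstPhase (γ : List MedialVertex) (δ : ℝ) (z : MedialVertex) : ℂ :=
  if z ∈ γ then phase (arrW γ δ (γ.idxOf z)) else 0

/-- The IN-minus-OUT sum of `γ` at `z`: over all visits `k` (`γ[k] = z`), phase on arrival minus phase on
departure, `Σ_k (e^{−(i/3)W_arr(k)} − e^{−(i/3)W_arr(k+1)})` — the visit form of the diagonal-staggered corner
mode: in-darts carry the arrival phase, out-darts the departure phase, and by the tree's dart orientation
(`cornerSource`/`cornerTarget`: site on the left) the in-darts of a horizontal edge are its NE, SW corners and
those of a vertical edge its NW, SE corners, so `stagger E E.δ (x, i) = (−1)^{i+1} · E[inOutSum]`. -/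
def inOutSum (γ : List MedialVertex) (δ : ℝ) (z : MedialVertex) : ℂ :=
  ∑ k ∈ (Finset.range γ.length).filter (fun k => γ[k]? = some z),
    (phase (arrW γ δ k) - phase (arrW γ δ (k + 1)))

/-- `S₁(E, z) = E[Φ₁]`: the first-visit amplitude at `z` of the exploration of the datum `E` under `P_{1/2}`. -/
def S1 (E : DiscreteDobrushin) (z : MedialVertex) : ℂ :=
  ∫ ω, firstPhase (medialExploration E ω) E.δ z ∂Pc

/-- `Y₊(E, z) = E[Φ₁ ; z revisited, first turn LEFT]`. -/
def Yplus (E : DiscreteDobrushin) (z : MedialVertex) : ℂ :=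
  ∫ ω, (if 2 ≤ (medialExploration E ω).count z ∧
      turnSign (medialExploration E ω) E.δ ((medialExploration E ω).idxOf z) = 1
    then firstPhase (medialExploration E ω) E.δ z else 0) ∂Pc

/-- `Y₋(E, z) = E[Φ₁ ; z revisited, first turn RIGHT]`. -/
def Yminus (E : DiscreteDobrushin) (z : MedialVertex) : ℂ :=
  ∫ ω, (if 2 ≤ (medialExploration E ω).count z ∧
      turnSign (medialExploration E ω) E.δ ((medialExploration E ω).idxOf z) = -1
    then firstPhase (medialExploration E ω) E.δ z else 0) ∂Pc

/-- The expected in-minus-out mode `S_inout(E, z) = E[inOutSum]`. -/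
def inOut (E : DiscreteDobrushin) (z : MedialVertex) : ℂ :=
  ∫ ω, inOutSum (medialExploration E ω) E.δ z ∂Pc

/-- The return tilt `g(τ) = e^{iτπ/3} − e^{iτπ/6}`: the contribution, per unit of first-arrival phase, of a
return whose first turn was `τ` (arrival winding shifted by `−τπ`, forced turn `τ`, out-dart factor `e^{−iτπ/6}`). -/
def gTilt (τ : ℝ) : ℂ :=
  Complex.exp (Complex.I * (τ : ℂ) * (Real.pi : ℂ) / 3) - Complex.exp (Complex.I * (τ : ℂ) * (Real.pi : ℂ) / 6)

/-! ### Diagonal geometry (the all-diagonal twin of the dead line's rectilinear vocabulary) -/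

/-- Diagonal unit directions (inward unit normals of sides of slope `±1`). -/
def IsDiagDir (η : ℂ) : Prop :=
  η = (1 + Complex.I) / (Real.sqrt 2 : ℂ) ∨ η = (1 - Complex.I) / (Real.sqrt 2 : ℂ) ∨
    η = (-1 + Complex.I) / (Real.sqrt 2 : ℂ) ∨ η = (-1 - Complex.I) / (Real.sqrt 2 : ℂ)

/-- A FLAT DIAGONAL FREE WINDOW of `D` (verbatim `IicTraceFluxPairing.IsFlatFreeWindow` with a diagonal inward
normal `η` instead of an axis one): the open box `{|tCoord| < a, |nCoord| < b}` at the boundary point `m` meets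
`D` exactly in its inner half, its mid-segment lies on the free arc `(ba) = D.arc 1`, and it avoids the marks. -/
structure IsDiagFreeWindow (D : DobrushinDomain) (m η : ℂ) (a b : ℝ) : Prop where
  diag : IsDiagDir η
  a_pos : 0 < a
  b_pos : 0 < b
  carrier_iff : ∀ z : ℂ, |tCoord m η z| < a → |nCoord m η z| < b → (z ∈ D.carrier ↔ 0 < nCoord m η z)
  subset_arc : ∀ z : ℂ, |tCoord m η z| < a → nCoord m η z = 0 → z ∈ D.arc 1
  marks : ∀ z : ℂ, |tCoord m η z| < a → |nCoord m η z| < b → z ≠ D.pt 0 ∧ z ≠ D.pt 1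

/-- TOUCH INTENSITY LAW with positive amplitude on DIAGONAL windows (verbatim `IicTraceFluxPairing.TouchLawPos`
with `IsDiagFreeWindow`): along every admissible family of `D` and on every flat diagonal free window, the
covariant weight-`1/3` density `ρ` (`HasTouchDensityAt`) exists on the window and, along every mesh sequence,
a subsequence of the renormalised touch intensities `touchFunctional` (phase-free: `δ^{2/3} Σ P(x ↔ A) g(δx)`
over touch sites — MONOTONE events) converges vaguely on the window to `c · ρ · (length)` with `c > 0`. -/
def TouchLawPosDiag (D : DobrushinDomain) : Prop :=
  ∀ Λ : ℝ → DiscreteDobrushin, IsFamily D Λ →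
    ∀ (m η : ℂ) (a b : ℝ), IsDiagFreeWindow D m η a b →
      ∃ ρ : ℂ → ℝ, (∀ y : ℂ, |tCoord m η y| < a → nCoord m η y = 0 → HasTouchDensityAt D y (ρ y)) ∧
        ∀ u : ℕ → ℝ, Tendsto u atTop (𝓝[>] (0:ℝ)) →
          ∃ (s : ℕ → ℕ) (c : ℝ), StrictMono s ∧ 0 < c ∧
            ∀ g : ℂ → ℝ, Continuous g → HasCompactSupport g →
              tsupport g ⊆ {z | |tCoord m η z| < a ∧ |nCoord m η z| < b} →
              Tendsto (fun k : ℕ => touchFunctional (Λ (u (s k))) g) atTop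
                (𝓝 (c * ∫ t in Set.Ioo (-a) a,
                  g (m + (t : ℂ) * (Complex.I * η)) * ρ (m + (t : ℂ) * (Complex.I * η))))

/-- ALL-DIAGONAL Dobrushin polygons: the Jordan boundary is a finite union of segments of slope `±1` (marks
anywhere on it) — the class on which every boundary corner has a lattice-determined phase AND the diagonal arm
bound N applies on every free side (the axis class `IsRectilinear` would need the axis bound = S2, dead). -/
def IsDiagRectilinear (D : DobrushinDomain) : Prop :=
  ∃ S : Finset (ℂ × ℂ), (∀ e ∈ S, (e.1 - e.2).re = (e.1 - e.2).im ∨ (e.1 - e.2).re = -(e.1 - e.2).im) ∧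
    frontier D.carrier = ⋃ e ∈ S, segment ℝ e.1 e.2

/-- Identification of every subsequential interface law as the chordal SLE₆ law, on all-diagonal polygons
(the diagonal twin of `IicTraceFluxPairing.IdentOnRectilinear`). -/
def IdentOnDiagRectilinear : Prop :=
  ∀ D : DobrushinDomain, IsDiagRectilinear D → ∀ Λ : ℝ → DiscreteDobrushin, IsFamily D Λ →
    ∀ μ : Measure (CurveClass ℂ), IsProbabilityMeasure μ → IsSubseqLimitLaw (iface D Λ) perc μ → IsSLELaw 6 D μ

/-! ## §2 The typed statements of the line -/

/-- **RL — the flip-involution return law** (the lever; exact, finite volume, provable now). For Jordan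
admissible data `E` (carrier a Dobrushin domain) and every INTERIOR free lattice edge `z` (an edge of `Ω_δ`
with both endpoints off both discrete arcs — so its state is read off `ω`, `DiscreteDobrushin.IsFreeEdge`, it
is neither `e_a`, `e_b` nor frozen, and all faces at its endpoints are inner as soon as one is,
`forall_isInnerFace_of_not_mem_arcs`; lead's reshape of the planner's "every free edge", see the module
docstring):
(i) `F(z) = obs E z = cos(π/12)·S₁ + e^{iπ/4}·Y₊ + e^{−iπ/4}·Y₋`;
(ii) `S_inout(z) = (1 − √3/2)·S₁ + g(1)·Y₊ + g(−1)·Y₋`;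
(iii) `Y₊ + Y₋ = S₁/2` (fair return).
Mechanism: at most two visits (two in-darts; `IsMedialExploration.nodup`); first visit: `τ₁` is decided by the
state of `z` alone, and `ω ↦ ω △ {z}` preserves `P_{1/2}` (`bondPercolation_half_map_symmDiff`), the prefix up
to the first arrival (hence `Φ₁`) and flips `τ₁` — symmetrisation gives the `cos(π/12)` and `1 − √3/2`
coefficients (`windingAt = arrW + τπ/4`); return: exactly one state of `z` returns (planar duality on the Jordan
carrier: far endpoint joined to the explored cluster avoiding `z` XOR far face dual-joined), with
`W_arr(k₂) = W_arr(k₁) − τ₁π` (Umlaufsatz for the non-self-crossing return loop, `MedialTrailUmlaufsatz`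
technology; FALSE on annular carriers, triage r2-1 — hence the Jordan binder) and `τ₂ = τ₁`. Verified:
exhaustive enumeration (boxes ≤ 6×5, notch, peninsula, L-shape: 0 violations; identities to 1e-13) and MC
`P(return ∣ visit) = 0.5000(1)` (triage r2-1, r2-2). (source: DuminilCopinSmirnov2012Lattice, proof of Prop. 8.6 — the edge flip) -/
def ReturnLaw : Prop :=
  ∀ (D : DobrushinDomain) (E : DiscreteDobrushin), E.Ω = D.carrier → E.IsZdAdmissible →
    ∀ z : MedialVertex, z ∈ (discreteDomainGraph E.Ω E.δ).edgeSet → (∀ y ∈ z, y ∉ E.zdArcA ∧ y ∉ E.zdArcB) →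
      obs E z = (Real.cos (Real.pi / 12) : ℂ) * S1 E z +
          Complex.exp (Complex.I * (Real.pi : ℂ) / 4) * Yplus E z +
          Complex.exp (-(Complex.I * (Real.pi : ℂ) / 4)) * Yminus E z ∧
      inOut E z = (1 - (Real.sqrt 3 : ℂ) / 2) * S1 E z + gTilt 1 * Yplus E z + gTilt (-1) * Yminus E z ∧
      Yplus E z + Yminus E z = S1 E z / 2

/-- **S0 (summed form) — the staggered corner mode is negligible in `L¹` on compacts at scale `δ^{1/3}`.**
Along every family with the crux's guards (`Ω = D`, mesh `δ`, eventually admissible) and for every compact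
`K ⊂ D`: `δ^{5/3} · Σ_{p : medial vertex over K} ‖stagger (Λ δ) δ p‖ → 0` as `δ → 0⁺` (`#{p over K} ≍ δ^{-2}`,
so: "the `K`-average of `δ^{-1/3}‖stagger‖` tends to `0`"). Strictly WEAKER than the pointwise
`StaggeredVanishingFamilies` (S3 of the dead line) and exactly what the `S`-side of the pairing in
`stub_touchLawDiag` consumes in the bulk (triage r2-2: "register S0 in the summed form; pointwise S3 is not
needed"). Numerics: bulk `|ΣS|/|ΣF|` = 1.4e-3, 5.7e-4, 2.4e-4, 1.1e-4, 4e-5 at L = 32…512 (∝ δ; kit j020773). -/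
def StaggerSummedVanishing : Prop :=
  ∀ (D : DobrushinDomain) (Λ : ℝ → DiscreteDobrushin), (∀ δ, (Λ δ).Ω = D.carrier) → (∀ δ, (Λ δ).δ = δ) →
    (∀ᶠ δ in 𝓝[>] (0:ℝ), (Λ δ).IsZdAdmissible) →
    ∀ K : Set ℂ, IsCompact K → K ⊆ D.carrier →
      Tendsto (fun δ : ℝ => δ ^ ((5:ℝ) / 3) *
          ∑ᶠ p : Site 2 × Fin 2,
            K.indicator (fun _ : ℂ => ‖stagger (Λ δ) δ p‖) (medialPoint δ (medialVertexOf p)))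
        (𝓝[>] (0:ℝ)) (𝓝 0)

/-- **MESO — the mesoscopic inner envelope, corner level** (S1 = `UniformInnerEnvelope` of the dead lines —
stated, like it, for the four corner observables `cornerObs`, so that it bounds the vertex observable `F`
AND the staggered mode `S` — weakened twice: any exponent `a < 1` instead of Koebe's `1/3`, and only at
depths `≥ δ^{1/3−ε}`, for EVERY `ε ∈ (0, 1/3)`; the thin layer below is killed inside `stub_touchLawDiag` by a
crude RSW arm bound, companion card claim (4), which needs the threshold exponent above `1/3 − c/3` for a
rigorous boundary arm exponent `c`, i.e. small `ε`). Along every family with the crux's guards and for every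
such `ε` there are `a < 1` and `C` with, eventually in `δ`, at every corner `(v, f)` of depth
`d = infDist(δv, Dᶜ) ≥ δ^{1/3−ε}`: `‖E_δ(v,f)‖ ≤ C·δ^{1/3}·d^{−a}` (not vacuous: a very negative `a` still forces
the sharp `δ^{1/3}` envelope; the collar sum is then `δ^{-2/3}·O(η^{1−a})`). Open (needs the `δ^{1/12}`
winding-phase cancellation below the two-arm bound, uniformly down to mesoscopic depth; shared with the
companion line); MC for crux 11387: `max|E|·R^{1/3} ≈ 0.63–1.0`, flat.
(source: DuminilCopinSmirnov2012Lattice, Conjecture 8.7 with Koebe distortion) -/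
def MesoEnvelope : Prop :=
  ∀ (D : DobrushinDomain) (Λ : ℝ → DiscreteDobrushin), (∀ δ, (Λ δ).Ω = D.carrier) → (∀ δ, (Λ δ).δ = δ) →
    (∀ᶠ δ in 𝓝[>] (0:ℝ), (Λ δ).IsZdAdmissible) →
    ∀ ε : ℝ, 0 < ε → ε < 1 / 3 → ∃ a : ℝ, a < 1 ∧ ∃ C : ℝ, ∀ᶠ δ in 𝓝[>] (0:ℝ),
      ∀ v f : Site 2, IsCorner v f → meshPoint δ v ∈ D.carrier →
        δ ^ ((1:ℝ) / 3 - ε) ≤ infDist (meshPoint δ v) D.carrierᶜ →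
          ‖cornerObs (Λ δ) δ v f‖ ≤ C * δ ^ ((1:ℝ) / 3) * (infDist (meshPoint δ v) D.carrierᶜ) ^ (-a)

/-- **N — the DIAGONAL half-plane one-arm lower bound up to constants**: `π◇(n) ≥ c·n^{-1/3}` eventually, for
the event "the origin is joined inside the diagonal half-box `{s ≤ 1, −n ≤ s, |d| ≤ n}` (`s = v₀+v₁`,
`d = v₀−v₁`) to its far sides" under `P_{1/2}` on bond-`ℤ²` — VERBATIM the conclusion of the landed conditional
theorem `IicTraceFluxPairing.diagHalfPlaneOneArmLower_eventually_of_ikhlefPonsaing` (p119507), so that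
`IkhlefPonsaingFirstPassage → DiagHalfPlaneOneArmLower` is kernel-checked glue (`diagArmLower_of_ikhlefPonsaing`).
Unconditionally OPEN (rigorous: `≥ c n^{-1/2}`); the axis form is S2 of the dead line (hardness certificate
p120880) and is NOT used — the line normalises on diagonal sides only.
(source: IkhlefPonsaing2012, Prop. 4.7) (source: SmirnovWerner2001, β₁⁺ = 1/3 on 𝕋) -/
def DiagHalfPlaneOneArmLower : Prop :=
  ∃ c : ℝ, 0 < c ∧ ∀ᶠ n : ℕ in atTop,
    c * (n : ℝ) ^ (-((1:ℝ) / 3)) ≤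
      (bondPercolation (zdGraph 2) half).real
        {ω | ∃ y : Site 2, (y 0 + y 1 = -(n : ℤ) ∨ y 0 - y 1 = (n : ℤ) ∨ y 0 - y 1 = -(n : ℤ)) ∧
          ω ∈ openConnIn {v : Site 2 | v 0 + v 1 ≤ 1 ∧ -(n : ℤ) ≤ v 0 + v 1 ∧
            -(n : ℤ) ≤ v 0 - v 1 ∧ v 0 - v 1 ≤ n} 0 y}


/-! ## §3 Registered algebraic glue -/

/-- RL (ii)+(iii) put the in/out mode in TILT FORM: `S_inout = (g(1) − g(−1))·Y₊ + ((1 − √3/2) + g(−1)/2)·S₁`,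
i.e. S0 at `z` ⟺ `Y₊ = w⋆·S₁` with `w⋆ = −((1 − √3/2) + g(−1)/2)/(g(1) − g(−1)) = 1/4 − i(2−√3)/4` (pure
algebra, recorded so that the card's equivalence "S3 ⟺ tilt law" is visible next to the vocabulary). -/
theorem inOut_eq_tilt_form : ReturnLaw → ∀ {D : DobrushinDomain} {E : DiscreteDobrushin}, E.Ω = D.carrier → E.IsZdAdmissible → ∀ {z : MedialVertex}, z ∈ (discreteDomainGraph E.Ω E.δ).edgeSet → (∀ y ∈ z, y ∉ E.zdArcA ∧ y ∉ E.zdArcB) → inOut E z = (gTilt 1 - gTilt (-1)) * Yplus E z + ((1 - (Real.sqrt 3 : ℂ) / 2) + gTilt (-1) / 2) * S1 E z := by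
  intro hRL D E hΩ hE z hz hzi
  obtain ⟨-, h2, h3⟩ := hRL D E hΩ hE z hz hzi
  have hYm : Yminus E z = S1 E z / 2 - Yplus E z := by rw [← h3]; ring
  rw [h2, hYm]
  ring

/-! ## §4 The summed phase-tilt law (lead a2, cycle 2: the honest form of S0)

With the return law landed (`stub_returnLaw`, `…FlipReturnLaw.lean`) and the dart bookkeeping
`stagger_eq_signed_inOut` (`…FlipStaggerInOut.lean`: `stagger E E.δ (x,i) = (−1)^{i+1}·inOut E s(x, x+eᵢ)`),
the staggered corner mode at an interior edge of Jordan admissible data IS the tilt defect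
`inOut = (g(1) − g(−1))·Y₊ + ((1 − √3/2) + g(−1)/2)·S₁ = (g(1) − g(−1))·(Y₊ − w⋆·S₁)`,
`w⋆ = 1/4 − i(2−√3)/4` (`inOut_eq_tilt_form`). So the summed S0 statement `StaggerSummedVanishing` is
EQUIVALENT, by proved bookkeeping, to the following summed phase-tilt law, which is the line's S0 content in
its pure analytic form (registered stub `stub_tiltLawSummed`; numerically `Im(Y₊/S₁) = −0.06699 ± 1e-4 =
−(2−√3)/4` at `L = 64…512`, kit j020697/j020773; OPEN: the `δ^{1/12}` race of the card). -/

/-- **The summed phase-tilt law** (S0 in tilt form). Along every family with the crux's guards (`Ω = D`,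
mesh `δ`, eventually admissible) and for every compact `K ⊂ D`: the `K`-sum of the norms of the TILT DEFECT
`(g(1) − g(−1))·Y₊(z) + ((1 − √3/2) + g(−1)/2)·S₁(z)` (`= (g(1) − g(−1))·(Y₊ − w⋆·S₁)`, `= inOut` by RL) over
the lattice edges `z` under `K` is `o(δ^{-5/3})`: `δ^{5/3}·Σ_{z over K} ‖…‖ → 0` as `δ → 0⁺`. OPEN (the
line's load-bearing new content); `TiltLawSummed ↔ StaggerSummedVanishing` is proved bookkeeping
(`staggerSummedVanishing_of_tiltLawSummed` and its converse, `…FlipStaggerSummedOfTilt.lean`). -/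
def TiltLawSummed : Prop :=
  ∀ (D : DobrushinDomain) (Λ : ℝ → DiscreteDobrushin), (∀ δ, (Λ δ).Ω = D.carrier) → (∀ δ, (Λ δ).δ = δ) →
    (∀ᶠ δ in 𝓝[>] (0:ℝ), (Λ δ).IsZdAdmissible) →
    ∀ K : Set ℂ, IsCompact K → K ⊆ D.carrier →
      Tendsto (fun δ : ℝ => δ ^ ((5:ℝ) / 3) *
          ∑ᶠ p : Site 2 × Fin 2,
            K.indicator (fun _ : ℂ => ‖(gTilt 1 - gTilt (-1)) * Yplus (Λ δ) (medialVertexOf p) +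
              ((1 - (Real.sqrt 3 : ℂ) / 2) + gTilt (-1) / 2) * S1 (Λ δ) (medialVertexOf p)‖)
              (medialPoint δ (medialVertexOf p)))
        (𝓝[>] (0:ℝ)) (𝓝 0)

end Summit.CriticalPhenomena.CardyFormulaZ2.Cruxes.ParafermionToSLESixFamilies.FlipInvolutionReturnLaw

end
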